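import Literature.MathematicalPhysics.QuantumFieldTheory.Balaban1983to89.LatticeFieldCalculus
import Literature.MathematicalPhysics.QuantumFieldTheory.Balaban1983to89.B8SectAStatements

/-!
# `Balaban1983to89.B8Eq111SiteCovariance` — T. Bałaban, *Spaces of regular gauge field configurations on a lattice and
# gauge fixing conditions*, Commun. Math. Phys. **99** (1985) 75–102 [Balaban1985RegularSpaces]: the gauge covariance (1.11)
# p. 77 of the covariant lattice derivatives (1.1)–(1.2), on the carriers of record (`LatticeFieldCalculus.covD` / `covDAdj` /
# `covDivPlaq` over `Setup.GaugeField` / `SiteField`), PROVED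

statement-level skeleton of published theorems with citation tags; proofs where landed; nothing here is a claim about the Yang–Mills mass gap

PDF held: `paper:balaban1985-cmp99-regular-spaces-gauge-fixing` (journal page = PDF page + 74); pp. 76–77 [PDF 2–3] were read
for this file on the cell's page renders `run/shared/lean/pub/pub-balaban/b2b-balaban-ref1/pages/1985-cmp99-regular-spaces-gauge-fixing/
…-p002-x2.png`, `…-p003-x2.png`, AS IMAGES.

CITATION HEADER — WHAT IS REPRODUCED.  SKELETON row «calculus row F21» (= B8.Eq1.11 read on the V1 calculus; r18
`SKELETON-r18.md` F21, PHASE2-TARGETS §G.3 seat line p40): the printed sentence and display of p. 77 [PDF 3], verbatim —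
*"These conditions are invariant with respect to gauge transformations. It is obvious for (1.7), (1.8). To see that (1.9) is
invariant also let us notice that (∂U^u)(p_{μν}(x)) = R(u(x))(∂U)(p_{μν}(x)), and if a function F transforms as
F^u(x) = R(u(x))F(x), then from (1.1) we get (D^{η*}_{U^u,ν}F^u)(x) = R(u(x))(D^{η*}_{U,ν}F)(x). (1.11) This and (1.2) imply
the invariance. Thus the space 𝔄_k({Ω_j}, α₀) is invariant with respect to gauge transformations."* — with (1.1)–(1.2)
p. 76 [PDF 2]: *"(D^η_{U,μ}F)(x) = η⁻¹(R(U(x, x+ηe_μ))F(x+ηe_μ) − F(x)), (D^{η*}_{U,μ}F)(x) = η⁻¹(R(U(x, x−ηe_μ))F(x−ηe_μ) − F(x)),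
(1.1) where U is an arbitrary gauge field configuration, and R(U)X = UXU⁻¹ for a unitary matrix U and an arbitrary X. …
(D^{η*}_U F)(x, x+ηe_μ) = (D^{η*}_U F)_μ(x) = Σ_{ν<μ}(D^{η*}_{U,ν}F_{νμ})(x) − Σ_{ν>μ}(D^{η*}_{U,ν}F_{μν})(x). (1.2)"* and the
gauge action *"U^u(x, x′) = u(x)U(x, x′)u⁻¹(x′)"* of [Balaban1985Averaging] (8) p. 19 (`Setup.GaugeField.gaugeAct`).

OVER WHICH CARRIERS.  The carriers OF RECORD of the cell (`Setup`: `Site P j`, `PBond P j`, `Plaq P j`, `GaugeField P j G`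
for an abstract `GaugeGroup G`, `SiteField P j V`) and r18's linear calculus `LatticeFieldCalculus` (p239006/p239225): `covD R c U μ`
= (1.1) first line, `covDAdj R c U μ` = (1.1) second line (the reversed bond carries `U(x, x−e_μ) = U(x−e_μ, x)⁻¹`), `covDivPlaq R c U`
= (1.2), all for a LINEAR REPRESENTATION `R : G → V →ₗ[ℝ] V` (print: `R(U)X = UXU⁻¹` on matrices).  The only property of `R` the
printed step uses is that it is a representation — `R(1) = 1`, `R(gh) = R(g)R(h)` ([Balaban1985Averaging] (57) p. 27
*"R(X)R(Y) = R(XY), R(X)⁻¹ = R(X⁻¹)"*) —; these are the explicit hypotheses `hone`, `hmul` below (the representation is a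
parameter of `covD`, so they cannot be hidden); for the norm statement, that `R(u(x))` is isometric (`hiso`; print: `u` unitary,
`|·|` the operator norm).  The same identity is ALREADY certified on two other carriers of the tree — `B8Ineq132.covDeriv_gaugeAct`
/ `covDiv_gaugeAct` (ℤᵈ, units of a Banach algebra, `R` = conjugation) and `T4AdjointCovariance.covDeriv_conjFun` (bond-field
valued, constant `u`) —; this file is the V1 («knitting») instance the calculus rows cite, nothing more.

WHAT IS PROVED (kernel-checked, no `sorry`, standard axioms; every `d`, every level `j`, every lattice factor `c`, every
`GaugeGroup G`, every `ℝ`-module `V`):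
* `covD_gaugeAct` — (1.1) first line under `U ↦ U^u`, `F ↦ F^u = R(u)F`: `(D_{U^u,μ}F^u)(x) = R(u(x))(D_{U,μ}F)(x)`;
* `covDAdj_gaugeAct` — **(1.11)**: `(D*_{U^u,ν}F^u)(x) = R(u(x))(D*_{U,ν}F)(x)`;
* `covDivPlaq_gaugeAct` — *"This and (1.2) imply"*: for a plaquette function transforming as `F^u(p_{μν}(x)) = R(u(x))F(p_{μν}(x))`,
  `(D*_{U^u}F^u)_μ(x) = R(u(x))(D*_U F)_μ(x)`;
* `repr_plaqHol_gaugeAct` — *"(∂U^u)(p_{μν}(x)) = R(u(x))(∂U)(p_{μν}(x))"* for the plaquette variables read in `V` through any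
  `G`-equivariant map `ι : G → V` (print: the inclusion of `U(N)` in the matrices, `R(u)X = uXu⁻¹`), and hence
  `covDivPlaq_plaqHol_gaugeAct` — `(D*_{U^u}∂U^u)_μ(x) = R(u(x))(D*_U ∂U)_μ(x)`;
* `norm_covDivPlaq_gaugeAct` / `norm_covDivPlaq_plaqHol_gaugeAct` — *"the invariance"* of the bond clause (1.9)
  `|(D^{η*}_U ∂U)(b)| < α₀L^{−2j}(Lʲη)⁻¹`: both sides of (1.9) have the same norm before and after the gauge transformation, for
  isometric `R(u(x))`.
* §3 (v3, MERGE of the first accepted version p243103 of this file, seat p40, per ruling G.5-31(b) — append-only, nothing of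
  the head deleted): the same family with the HYPOTHESIS PAIR of `T4AdjointCovariance.covDeriv_conjFun` — `hmul : R(gh) = R(g)R(h)`,
  `hinv : R(g⁻¹)R(g) = 1` ([Balaban1985Averaging] (57) p. 27 *"R(X)R(Y) = R(XY), R(X)⁻¹ = R(X⁻¹)"*) — instead of (`hone`, `hmul`)
  (the two systems are equivalent: `repr_one_of_mul_inv` / `repr_inv_apply`), and with the transformed function given ABSTRACTLY by
  `hF : ∀ z, F^u(z) = R(u(z))F(z)` as in the printed sentence *"if a function F transforms as F^u(x) = R(u(x))F(x)"*:
  `covD_gaugeAct_inv` / `covD_gaugeAct_inv'`, `covDAdj_gaugeAct_inv` (= (1.11)) / `covDAdj_gaugeAct_inv'`, `covDivPlaq_gaugeAct_inv`,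
  `norm_covDivPlaq_gaugeAct_inv`; and the HYPOTHESIS-FREE forms for a representation packaged as a monoid hom
  `ρ : G →* (V →ₗ[ℝ] V)`: `covD_gaugeAct_rep`, `covDAdj_gaugeAct_rep`, `covDivPlaq_gaugeAct_rep` (the p243103 names
  `covDAdj_gaugeAct'`, `covD_gaugeAct'` are restored as `…_inv'`; its `covDAdj_gaugeAct`, `covD_gaugeAct`, `covDivPlaq_gaugeAct`,
  `norm_covDivPlaq_gaugeAct` — which clash with the head's names — as `…_inv`).
* §4 (v3.1, append-only): the two sentences around (1.11) AT THE LEVEL OF THE CLASSES, p. 77 verbatim *"These conditions are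
  invariant with respect to gauge transformations. It is obvious for (1.7), (1.8)."* and *"Thus the space 𝔄_k({Ω_j}, α₀) is
  invariant with respect to gauge transformations."*: `inAkOn_gaugeAct_iff` (the k-level plaquette clause (1.7) =
  `B8SectAStatements.InAkOn`; (1.8) is the same inequality, `α₀η²(Lʲη)⁻² = α₀L^{−2j}`), `wilsonSmallOn_gaugeAct_iff` /
  `inAkWilson_gaugeAct_iff` (the equivalent form (1.10) = `B8SectAStatements.WilsonSmallOn` / `InAkWilson`),
  `bondClause19_gaugeAct_iff` (the k-level bond clause (1.9) «|(D^{η*}_U ∂U)(b)| < α₀L^{−2j}(Lʲη)⁻¹, b ∈ Ω_j, j ≤ k» written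
  out over `covDivPlaq` — it has no named V1 predicate; ℤᵈ: `B8Ineq132.CondAt`), and the conjunction `classAk_gaugeAct_iff`
  (𝔄_k({Ω_j}, α₀) = (1.7) ∧ (1.9) is gauge invariant).  One-level forms of the plaquette half exist as
  `T4ReTrLipUnitary.plaqHol_gaugeAct` / `plaqSmallOn_gaugeAct_iff` (not imported: that module pulls `UnitaryModel` and more).
DELIBERATELY NOT HERE: the class `𝔄_k({Ω_j}, α₀)` itself on V1 (its plaquette clauses (1.7)/(1.10) are `B8SectAStatements.InAkOn` /
`InAkWilson`; the bond clause (1.9) is typed on the ℤᵈ carrier only, `B8Ineq132.CondAt` — recorded there); no estimate of B8.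

AUTHORS / VERSIONS.  v1 p243103 (seat p40 `literature-prover-lit-balaban-p40-0`, ACCEPTED 6d3c0448614e: the `…_inv` / `…_rep` family,
then at top level); v2 p243160 (seat p16 `literature-prover-lit-balaban-p16-0`, ACCEPTED 4e54fa7257bd: §§0–2 below, which replaced v1 at
the tree head — ruling G.5-31); v3 (seat p40 gen 2 `literature-prover-lit-balaban-p40-g2-0`, merge owner named by G.5-31(b)): §§0–2 =
v2 VERBATIM, §3 = the v1 statements re-landed under non-clashing names and proved by reduction to §§1–2.  Both seats are authors.
Units `lit-balaban-p16` (Phase-2 proof seat p16) and `lit-balaban-p40` (Phase-2 proof seat p40, seat line p40 = calculus row F21 of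
PHASE2-TARGETS §G.3), HOME `run/shared/lean/pub/lit-balaban/` (seat dirs `lit-balaban-p16/`, `lit-balaban-p40/`), 2026-08-21.
-/

namespace Literature.MathematicalPhysics.QuantumFieldTheory.Balaban1983to89.B8Eq111SiteCovariance

open Literature.MathematicalPhysics.QuantumFieldTheory.Balaban1983to89
open LatticeFieldCalculus GaugeField

variable {P : Params} {j : ℕ} {G : Type*} [GaugeGroup G]

/-! ## §0 Site bookkeeping (private) -/

/-- The positively oriented bond ending at `x` in direction `μ` starts at `x − e_μ`: `⟨x − e_μ, μ⟩₊ = x`. [folklore] -/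
private theorem tgt_unshift_mk (x : Site P j) (μ : Fin P.d) : (⟨x.unshift μ, μ⟩ : PBond P j).tgt = x := by
  funext ν
  by_cases h : ν = μ
  · subst h
    simp [PBond.tgt, Site.shift, Site.unshift]
  · simp [PBond.tgt, Site.shift, Site.unshift, Function.update_of_ne h]

/-- The far corner of a plaquette does not depend on the order of the two steps: `x + e_μ + e_ν = x + e_ν + e_μ`. [folklore] -/
private theorem shift_shift_comm (x : Site P j) (μ ν : Fin P.d) : (x.shift μ).shift ν = (x.shift ν).shift μ := by
  funext κ
  by_cases h1 : κ = ν
  · subst h1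
    by_cases h2 : κ = μ
    · subst h2; rfl
    · simp [Site.shift, Function.update_of_ne h2]
  · by_cases h2 : κ = μ
    · subst h2
      simp [Site.shift, Function.update_of_ne h1]
    · simp [Site.shift, Function.update_of_ne h1, Function.update_of_ne h2]

section Linear

variable {V : Type*} [AddCommGroup V] [Module ℝ V]

/-- A representation cancels inverses: `R(g⁻¹)R(g) = 1` from `R(1) = 1`, `R(gh) = R(g)R(h)`
([Balaban1985Averaging] (57) "R(X)⁻¹ = R(X⁻¹)"). [folklore] -/
private theorem repr_inv_apply {R : G → V →ₗ[ℝ] V} (hone : ∀ v, R 1 v = v)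
    (hmul : ∀ (g h : G) (v : V), R (g * h) v = R g (R h v)) (g : G) (v : V) : R g⁻¹ (R g v) = v := by
  rw [← hmul, inv_mul_cancel, hone]

/-- **(1.1), first line, under a gauge transformation** (the forward companion of (1.11), same mechanism): for
`U^u(x, x′) = u(x)U(x, x′)u(x′)⁻¹` ([Balaban1985Averaging] (8)) and `F^u(x) = R(u(x))F(x)`,
`(D_{U^u,μ}F^u)(x) = R(u(x))(D_{U,μ}F)(x)` — for every linear representation `R` of `G` on `V` (`hone`, `hmul`).
[cite: Balaban1985RegularSpaces, (1.1) p.76] -/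
theorem covD_gaugeAct {R : G → V →ₗ[ℝ] V} (hone : ∀ v, R 1 v = v)
    (hmul : ∀ (g h : G) (v : V), R (g * h) v = R g (R h v)) (c : ℝ) (u : GaugeTransf P j G) (U : GaugeField P j G)
    (μ : Fin P.d) (F : SiteField P j V) (x : Site P j) :
    covD R c (gaugeAct u U) μ (fun z => R (u z) (F z)) x = R (u x) (covD R c U μ F x) := by
  simp only [covD, gaugeAct, PBond.tgt, map_sub, map_smul]
  rw [hmul, hmul, repr_inv_apply hone hmul]

/-- **(1.11)** p. 77 [PDF 3], verbatim: *"if a function F transforms as F^u(x) = R(u(x))F(x), then from (1.1) we get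
(D^{η*}_{U^u,ν}F^u)(x) = R(u(x))(D^{η*}_{U,ν}F)(x). (1.11)"* — typed reading: the backward covariant derivative `covDAdj` of (1.1)
(reversed bond variable `U(x, x−e_ν) = U(x−e_ν, x)⁻¹`, lattice factor `c = η⁻¹`) at the gauge-transformed background
`gaugeAct u U` applied to `x ↦ R(u(x))F(x)`; hypotheses: `R` a representation (`hone`, `hmul`).
[cite: Balaban1985RegularSpaces, (1.11) p.77] -/
theorem covDAdj_gaugeAct {R : G → V →ₗ[ℝ] V} (hone : ∀ v, R 1 v = v)
    (hmul : ∀ (g h : G) (v : V), R (g * h) v = R g (R h v)) (c : ℝ) (u : GaugeTransf P j G) (U : GaugeField P j G)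
    (ν : Fin P.d) (F : SiteField P j V) (x : Site P j) :
    covDAdj R c (gaugeAct u U) ν (fun z => R (u z) (F z)) x = R (u x) (covDAdj R c U ν F x) := by
  simp only [covDAdj, gaugeAct, tgt_unshift_mk, map_sub, map_smul, mul_inv_rev, inv_inv]
  rw [hmul, hmul, repr_inv_apply hone hmul]

/-- **"This and (1.2) imply the invariance"** (p. 77, after (1.11)): for a plaquette function transforming as
`F^u(p_{μν}(x)) = R(u(x))F(p_{μν}(x))` (hypothesis `hF`; `x = p_{μν}(x)₋` is `Plaq.src`), the covariant divergence (1.2)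
transforms the same way: `(D*_{U^u}F^u)_μ(x) = R(u(x))(D*_U F)_μ(x)` at every bond `⟨x, x + e_μ⟩`.
[cite: Balaban1985RegularSpaces, (1.2) p.76] -/
theorem covDivPlaq_gaugeAct {R : G → V →ₗ[ℝ] V} (hone : ∀ v, R 1 v = v)
    (hmul : ∀ (g h : G) (v : V), R (g * h) v = R g (R h v)) (c : ℝ) (u : GaugeTransf P j G) (U : GaugeField P j G)
    {F Fu : Plaq P j → V} (hF : ∀ p, Fu p = R (u p.src) (F p)) (b : PBond P j) :
    covDivPlaq R c (gaugeAct u U) Fu b = R (u b.src) (covDivPlaq R c U F b) := by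
  simp only [covDivPlaq, map_sub, map_sum]
  congr 1
  · refine Finset.sum_congr rfl fun ν _ => ?_
    split_ifs with h
    · have e : (fun z => Fu ⟨z, ν, b.dir, h⟩) = fun z => R (u z) (F ⟨z, ν, b.dir, h⟩) := funext fun z => hF _
      rw [e, covDAdj_gaugeAct hone hmul]
    · rw [map_zero]
  · refine Finset.sum_congr rfl fun ν _ => ?_
    split_ifs with h
    · have e : (fun z => Fu ⟨z, b.dir, ν, h⟩) = fun z => R (u z) (F ⟨z, b.dir, ν, h⟩) := funext fun z => hF _
      rw [e, covDAdj_gaugeAct hone hmul]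
    · rw [map_zero]

/-- **"(∂U^u)(p_{μν}(x)) = R(u(x))(∂U)(p_{μν}(x))"** (p. 77, the sentence before (1.11)): the plaquette variables
`U(∂p) = (∂U)(p)` ([Balaban1985Averaging] (9); `GaugeField.plaqHol`) read in the representation space through a map
`ι : G → V` intertwining conjugation with `R` (`hι : ι(g h g⁻¹) = R(g)ι(h)`; print: the inclusion `U(N) ⊂ M_N(ℂ)` with
`R(u)X = uXu⁻¹`) transform as `ι((∂U^u)(p)) = R(u(p₋))ι((∂U)(p))` — the four gauge factors at the inner corners telescope.
[cite: Balaban1985RegularSpaces, p.77 (sentence before (1.11))] -/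
theorem repr_plaqHol_gaugeAct {R : G → V →ₗ[ℝ] V} {ι : G → V} (hι : ∀ g h : G, ι (g * h * g⁻¹) = R g (ι h))
    (u : GaugeTransf P j G) (U : GaugeField P j G) (p : Plaq P j) :
    ι (plaqHol (gaugeAct u U) p) = R (u p.src) (ι (plaqHol U p)) := by
  rw [← hι]
  congr 1
  simp only [plaqHol, gaugeAct, PBond.tgt, shift_shift_comm p.src p.ν p.μ, mul_inv_rev, inv_inv]
  group

/-- **The printed consequence for `F = ∂U`**: `(D^{η*}_{U^u}∂U^u)_μ(x) = R(u(x))(D^{η*}_U ∂U)_μ(x)` — (1.11) summed as in (1.2),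
with the plaquette field `p ↦ ι(U(∂p))` (`hι` as in `repr_plaqHol_gaugeAct`; `R` a representation).
[cite: Balaban1985RegularSpaces, p.77 ("This and (1.2) imply the invariance")] -/
theorem covDivPlaq_plaqHol_gaugeAct {R : G → V →ₗ[ℝ] V} (hone : ∀ v, R 1 v = v)
    (hmul : ∀ (g h : G) (v : V), R (g * h) v = R g (R h v)) {ι : G → V}
    (hι : ∀ g h : G, ι (g * h * g⁻¹) = R g (ι h)) (c : ℝ) (u : GaugeTransf P j G) (U : GaugeField P j G)
    (b : PBond P j) :
    covDivPlaq R c (gaugeAct u U) (fun p => ι (plaqHol (gaugeAct u U) p)) b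
      = R (u b.src) (covDivPlaq R c U (fun p => ι (plaqHol U p)) b) :=
  covDivPlaq_gaugeAct hone hmul c u U (fun p => repr_plaqHol_gaugeAct hι u U p) b

end Linear

/-! ## The invariance of the bond clause (1.9) `|(D^{η*}_U ∂U)(b)| < α₀L^{−2j}(Lʲη)⁻¹` -/

section Normed

variable {V : Type*} [NormedAddCommGroup V] [NormedSpace ℝ V]

/-- **"This and (1.2) imply the invariance"** (p. 77) in the form the bond clause (1.9) uses: when every `R(u(x))` is an
ISOMETRY (`hiso`; print: `u` unitary, `|·|` the operator norm), the covariant divergence of a covariantly transforming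
plaquette function has the same norm before and after the gauge transformation, `|(D*_{U^u}F^u)_μ(x)| = |(D*_U F)_μ(x)|`, so each
inequality (1.9) holds for `(U^u, F^u)` iff it holds for `(U, F)`. [cite: Balaban1985RegularSpaces, (1.9) p.77] -/
theorem norm_covDivPlaq_gaugeAct {R : G → V →ₗ[ℝ] V} (hone : ∀ v, R 1 v = v)
    (hmul : ∀ (g h : G) (v : V), R (g * h) v = R g (R h v)) {u : GaugeTransf P j G}
    (hiso : ∀ (x : Site P j) (v : V), ‖R (u x) v‖ = ‖v‖) (c : ℝ) (U : GaugeField P j G) {F Fu : Plaq P j → V}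
    (hF : ∀ p, Fu p = R (u p.src) (F p)) (b : PBond P j) :
    ‖covDivPlaq R c (gaugeAct u U) Fu b‖ = ‖covDivPlaq R c U F b‖ := by
  rw [covDivPlaq_gaugeAct hone hmul c u U hF, hiso]

/-- **(1.9) is gauge invariant** (p. 77: *"Thus the space 𝔄_k({Ω_j}, α₀) is invariant with respect to gauge transformations"*,
the bond clause): `|(D^{η*}_{U^u}∂U^u)(b)| = |(D^{η*}_U ∂U)(b)|` for the plaquette field `p ↦ ι(U(∂p))`, `R` a representation with
isometric `R(u(x))`, `ι` intertwining (`hι`). [cite: Balaban1985RegularSpaces, (1.9) p.77] -/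
theorem norm_covDivPlaq_plaqHol_gaugeAct {R : G → V →ₗ[ℝ] V} (hone : ∀ v, R 1 v = v)
    (hmul : ∀ (g h : G) (v : V), R (g * h) v = R g (R h v)) {ι : G → V}
    (hι : ∀ g h : G, ι (g * h * g⁻¹) = R g (ι h)) {u : GaugeTransf P j G}
    (hiso : ∀ (x : Site P j) (v : V), ‖R (u x) v‖ = ‖v‖) (c : ℝ) (U : GaugeField P j G) (b : PBond P j) :
    ‖covDivPlaq R c (gaugeAct u U) (fun p => ι (plaqHol (gaugeAct u U) p)) b‖
      = ‖covDivPlaq R c U (fun p => ι (plaqHol U p)) b‖ := by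
  rw [covDivPlaq_plaqHol_gaugeAct hone hmul hι, hiso]

end Normed

/-! ## §3 The same family with the hypotheses (`hmul`, `hinv`) of `T4AdjointCovariance.covDeriv_conjFun`, an abstract `F^u`,
and the hypothesis-free monoid-hom forms (v1 p243103 of this file, seat p40, re-landed append-only per ruling G.5-31(b))

Print ([Balaban1985Averaging] (57) p. 27): *"R(X)R(Y) = R(XY), R(X)⁻¹ = R(X⁻¹)"* — read as `hmul : R(gh)v = R(g)(R(h)v)` and
`hinv : R(g⁻¹)(R(g)v) = v`; together they give `R(1) = 1` (`repr_one_of_mul_inv`), so every statement of §§1–2 is available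
under this pair, and conversely (`repr_inv_apply`).  The transformed function is an arbitrary `Fu` with
`hF : ∀ z, Fu z = R(u z)(F z)` (print: *"if a function F transforms as F^u(x) = R(u(x))F(x)"*), which is how the calculus rows
downstream quote (1.11) (the transformed field is usually a named object, not a literal `fun z => R (u z) (F z)`). -/

section InvHyp

variable {V : Type*} [AddCommGroup V] [Module ℝ V]

/-- `R(1) = 1` from `R(gh) = R(g)R(h)` and `R(g⁻¹)R(g) = 1`: `R(1)v = R(1·1)v = R(1)(R(1)v) = R(1⁻¹)(R(1)v) = v`.
([Balaban1985Averaging] (57) p. 27.) [folklore] -/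
private theorem repr_one_of_mul_inv {R : G → V →ₗ[ℝ] V} (hmul : ∀ (g h : G) (v : V), R (g * h) v = R g (R h v))
    (hinv : ∀ (g : G) (v : V), R g⁻¹ (R g v) = v) (v : V) : R 1 v = v := by
  have h := hinv 1 v
  rwa [inv_one, ← hmul, mul_one] at h

/-- **(1.1), first line, under a gauge transformation**, hypotheses (`hmul`, `hinv`) and an abstract transformed function:
if `F^u(z) = R(u(z))F(z)` for all `z` (`hF`), then `(D_{U^u,μ}F^u)(x) = R(u(x))(D_{U,μ}F)(x)`.  (v1 p243103 name: `covD_gaugeAct`.)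
[cite: Balaban1985RegularSpaces, (1.1) p.76] -/
theorem covD_gaugeAct_inv {R : G → V →ₗ[ℝ] V} (hmul : ∀ (g h : G) (v : V), R (g * h) v = R g (R h v))
    (hinv : ∀ (g : G) (v : V), R g⁻¹ (R g v) = v) (c : ℝ) (u : GaugeTransf P j G) (U : GaugeField P j G)
    (μ : Fin P.d) {F Fu : SiteField P j V} (hF : ∀ z, Fu z = R (u z) (F z)) (x : Site P j) :
    covD R c (gaugeAct u U) μ Fu x = R (u x) (covD R c U μ F x) := by
  obtain rfl : Fu = fun z => R (u z) (F z) := funext hF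
  exact covD_gaugeAct (repr_one_of_mul_inv hmul hinv) hmul c u U μ F x

/-- **(1.1), first line, under a gauge transformation**, hypotheses (`hmul`, `hinv`), transformed function written out:
`(D_{U^u,μ}(R(u)F))(x) = R(u(x))(D_{U,μ}F)(x)`.  (v1 p243103 name: `covD_gaugeAct'`.) [cite: Balaban1985RegularSpaces, (1.1) p.76] -/
theorem covD_gaugeAct_inv' {R : G → V →ₗ[ℝ] V} (hmul : ∀ (g h : G) (v : V), R (g * h) v = R g (R h v))
    (hinv : ∀ (g : G) (v : V), R g⁻¹ (R g v) = v) (c : ℝ) (u : GaugeTransf P j G) (U : GaugeField P j G)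
    (μ : Fin P.d) (F : SiteField P j V) (x : Site P j) :
    covD R c (gaugeAct u U) μ (fun z => R (u z) (F z)) x = R (u x) (covD R c U μ F x) :=
  covD_gaugeAct (repr_one_of_mul_inv hmul hinv) hmul c u U μ F x

/-- **(1.11)** p. 77 [PDF 3], verbatim: *"if a function F transforms as F^u(x) = R(u(x))F(x), then from (1.1) we get
(D^{η*}_{U^u,ν}F^u)(x) = R(u(x))(D^{η*}_{U,ν}F)(x). (1.11)"* — with the transformation law as the hypothesis `hF` on an arbitrary
`F^u = Fu` and the representation properties (57) of [Balaban1985Averaging] as (`hmul`, `hinv`) (the binders of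
`T4AdjointCovariance.covDeriv_conjFun`).  (v1 p243103 name: `covDAdj_gaugeAct`.) [cite: Balaban1985RegularSpaces, (1.11) p.77] -/
theorem covDAdj_gaugeAct_inv {R : G → V →ₗ[ℝ] V} (hmul : ∀ (g h : G) (v : V), R (g * h) v = R g (R h v))
    (hinv : ∀ (g : G) (v : V), R g⁻¹ (R g v) = v) (c : ℝ) (u : GaugeTransf P j G) (U : GaugeField P j G)
    (ν : Fin P.d) {F Fu : SiteField P j V} (hF : ∀ z, Fu z = R (u z) (F z)) (x : Site P j) :
    covDAdj R c (gaugeAct u U) ν Fu x = R (u x) (covDAdj R c U ν F x) := by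
  obtain rfl : Fu = fun z => R (u z) (F z) := funext hF
  exact covDAdj_gaugeAct (repr_one_of_mul_inv hmul hinv) hmul c u U ν F x

/-- **(1.11)**, hypotheses (`hmul`, `hinv`), transformed function written out: `(D*_{U^u,ν}(R(u)F))(x) = R(u(x))(D*_{U,ν}F)(x)`.
(v1 p243103 name: `covDAdj_gaugeAct'`.) [cite: Balaban1985RegularSpaces, (1.11) p.77] -/
theorem covDAdj_gaugeAct_inv' {R : G → V →ₗ[ℝ] V} (hmul : ∀ (g h : G) (v : V), R (g * h) v = R g (R h v))
    (hinv : ∀ (g : G) (v : V), R g⁻¹ (R g v) = v) (c : ℝ) (u : GaugeTransf P j G) (U : GaugeField P j G)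
    (ν : Fin P.d) (F : SiteField P j V) (x : Site P j) :
    covDAdj R c (gaugeAct u U) ν (fun z => R (u z) (F z)) x = R (u x) (covDAdj R c U ν F x) :=
  covDAdj_gaugeAct (repr_one_of_mul_inv hmul hinv) hmul c u U ν F x

/-- **"This and (1.2) imply the invariance"** (p. 77), hypotheses (`hmul`, `hinv`): for a plaquette function with
`F^u(p) = R(u(p₋))F(p)` (`hF`), `(D*_{U^u}F^u)_μ(x) = R(u(x))(D*_U F)_μ(x)`.  (v1 p243103 name: `covDivPlaq_gaugeAct`.)
[cite: Balaban1985RegularSpaces, (1.2) p.76] -/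
theorem covDivPlaq_gaugeAct_inv {R : G → V →ₗ[ℝ] V} (hmul : ∀ (g h : G) (v : V), R (g * h) v = R g (R h v))
    (hinv : ∀ (g : G) (v : V), R g⁻¹ (R g v) = v) (c : ℝ) (u : GaugeTransf P j G) (U : GaugeField P j G)
    {F Fu : Plaq P j → V} (hF : ∀ p, Fu p = R (u p.src) (F p)) (b : PBond P j) :
    covDivPlaq R c (gaugeAct u U) Fu b = R (u b.src) (covDivPlaq R c U F b) :=
  covDivPlaq_gaugeAct (repr_one_of_mul_inv hmul hinv) hmul c u U hF b

/-- **(1.1), first line, under a gauge transformation — hypothesis-free form** for a representation packaged as a monoid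
homomorphism `ρ : G →* (V →ₗ[ℝ] V)` (so `ρ(1) = 1`, `ρ(gh) = ρ(g)ρ(h)` hold by `map_one` / `map_mul`):
`(D_{U^u,μ}(ρ(u)F))(x) = ρ(u(x))(D_{U,μ}F)(x)`. [cite: Balaban1985RegularSpaces, (1.1) p.76] -/
theorem covD_gaugeAct_rep (ρ : G →* (V →ₗ[ℝ] V)) (c : ℝ) (u : GaugeTransf P j G) (U : GaugeField P j G) (μ : Fin P.d)
    (F : SiteField P j V) (x : Site P j) :
    covD (fun g => ρ g) c (gaugeAct u U) μ (fun z => ρ (u z) (F z)) x = ρ (u x) (covD (fun g => ρ g) c U μ F x) :=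
  covD_gaugeAct (R := fun g => ρ g) (fun v => by simp) (fun g h v => by simp) c u U μ F x

/-- **(1.11) — hypothesis-free form** for a representation packaged as a monoid homomorphism `ρ : G →* (V →ₗ[ℝ] V)`:
`(D*_{U^u,ν}(ρ(u)F))(x) = ρ(u(x))(D*_{U,ν}F)(x)`.  (v1 p243103 name: `covDAdj_gaugeAct_rep`.) [cite: Balaban1985RegularSpaces, (1.11) p.77] -/
theorem covDAdj_gaugeAct_rep (ρ : G →* (V →ₗ[ℝ] V)) (c : ℝ) (u : GaugeTransf P j G) (U : GaugeField P j G) (ν : Fin P.d)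
    (F : SiteField P j V) (x : Site P j) :
    covDAdj (fun g => ρ g) c (gaugeAct u U) ν (fun z => ρ (u z) (F z)) x = ρ (u x) (covDAdj (fun g => ρ g) c U ν F x) :=
  covDAdj_gaugeAct (R := fun g => ρ g) (fun v => by simp) (fun g h v => by simp) c u U ν F x

/-- **"This and (1.2) imply the invariance" — hypothesis-free form** for `ρ : G →* (V →ₗ[ℝ] V)`: for a plaquette function
with `F^u(p) = ρ(u(p₋))F(p)` (`hF`), `(D*_{U^u}F^u)_μ(x) = ρ(u(x))(D*_U F)_μ(x)`. [cite: Balaban1985RegularSpaces, (1.2) p.76] -/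
theorem covDivPlaq_gaugeAct_rep (ρ : G →* (V →ₗ[ℝ] V)) (c : ℝ) (u : GaugeTransf P j G) (U : GaugeField P j G)
    {F Fu : Plaq P j → V} (hF : ∀ p, Fu p = ρ (u p.src) (F p)) (b : PBond P j) :
    covDivPlaq (fun g => ρ g) c (gaugeAct u U) Fu b = ρ (u b.src) (covDivPlaq (fun g => ρ g) c U F b) :=
  covDivPlaq_gaugeAct (R := fun g => ρ g) (fun v => by simp) (fun g h v => by simp) c u U hF b

end InvHyp

section InvHypNormed

variable {V : Type*} [NormedAddCommGroup V] [NormedSpace ℝ V]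

/-- **The invariance of the bond clause (1.9)**, hypotheses (`hmul`, `hinv`) and isometric `R(u(x))` (`hiso`): the covariant
divergence of a covariantly transforming plaquette function (`hF`) has the same norm before and after the gauge transformation,
`|(D*_{U^u}F^u)_μ(x)| = |(D*_U F)_μ(x)|`.  (v1 p243103 name: `norm_covDivPlaq_gaugeAct`.) [cite: Balaban1985RegularSpaces, (1.9) p.77] -/
theorem norm_covDivPlaq_gaugeAct_inv {R : G → V →ₗ[ℝ] V} (hmul : ∀ (g h : G) (v : V), R (g * h) v = R g (R h v))
    (hinv : ∀ (g : G) (v : V), R g⁻¹ (R g v) = v) {u : GaugeTransf P j G}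
    (hiso : ∀ (x : Site P j) (v : V), ‖R (u x) v‖ = ‖v‖) (c : ℝ) (U : GaugeField P j G) {F Fu : Plaq P j → V}
    (hF : ∀ p, Fu p = R (u p.src) (F p)) (b : PBond P j) :
    ‖covDivPlaq R c (gaugeAct u U) Fu b‖ = ‖covDivPlaq R c U F b‖ :=
  norm_covDivPlaq_gaugeAct (repr_one_of_mul_inv hmul hinv) hmul hiso c U hF b

end InvHypNormed

/-! ## §4 (v3.1) The invariance AT THE LEVEL OF THE CLASSES — p. 77: *"These conditions are invariant with respect to gauge
transformations. It is obvious for (1.7), (1.8). … Thus the space 𝔄_k({Ω_j}, α₀) is invariant with respect to gauge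
transformations."*

The plaquette clauses of `𝔄_k` on the carriers of record are `B8SectAStatements.InAkOn` ((1.7): `k + 1` levels of
`Setup.PlaqSmallOn` with thresholds `α₀L^{−2j}`; (1.8) *"|U(∂p) − 1| < α₀η²(Lʲη)⁻² for p ∈ Ω_j"* is the SAME inequality,
`α₀η²(Lʲη)⁻² = α₀L^{−2j}`) and, in the equivalent form (1.10), `B8SectAStatements.WilsonSmallOn` / `InAkWilson`.  *"It is
obvious"*: `U^u(∂p) = u(x)U(∂p)u(x)⁻¹` for the plaquette `p` at `x` (the four inner gauge factors of [Balaban1985Averaging] (8)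
telescope around (9)) and `|·|`, `Re tr` are conjugation invariant (`GaugeGroup.dist1_conj`, `GaugeGroup.reTr_conj`).  The bond
clause (1.9) has no named V1 predicate; it is written out over `covDivPlaq` with the plaquette field `p ↦ ι(U(∂p))` of §1 and
the printed thresholds `α₀L^{−2j}(Lʲη)⁻¹` (lattice factor `c = η⁻¹` in (1.1)), for an arbitrary family of bond sets
`Ωb j` (print: the bonds of Ω_j, *"Ω_j denotes also a set of bonds"*). -/

section ClassInvariance

/-- `U^u(∂p) = u(p₋) U(∂p) u(p₋)⁻¹` ([Balaban1985Averaging] (8)–(9); one-level twin of `T4ReTrLipUnitary.plaqHol_gaugeAct`,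
re-proved to keep this file's imports small). [cite: Balaban1985Averaging, (9) p.19] -/
private theorem plaqHol_gaugeAct_conj (u : GaugeTransf P j G) (U : GaugeField P j G) (p : Plaq P j) :
    plaqHol (gaugeAct u U) p = u p.src * plaqHol U p * (u p.src)⁻¹ := by
  simp only [plaqHol, gaugeAct, PBond.tgt, shift_shift_comm p.src p.ν p.μ, mul_inv_rev, inv_inv]
  group

/-- `|U^u(∂p) − 1| = |U(∂p) − 1|` (`dist1` is conjugation invariant). [cite: Balaban1985RegularSpaces, (1.7) p.77] -/
private theorem dist1_plaqHol_gaugeAct (u : GaugeTransf P j G) (U : GaugeField P j G) (p : Plaq P j) :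
    dist1 (plaqHol (gaugeAct u U) p) = dist1 (plaqHol U p) := by
  rw [plaqHol_gaugeAct_conj, GaugeGroup.dist1_conj]

/-- `Re tr U^u(∂p) = Re tr U(∂p)` (`reTr` is conjugation invariant). [cite: Balaban1985RegularSpaces, (1.10) p.77] -/
private theorem reTr_plaqHol_gaugeAct (u : GaugeTransf P j G) (U : GaugeField P j G) (p : Plaq P j) :
    reTr (plaqHol (gaugeAct u U) p) = reTr (plaqHol U p) := by
  rw [plaqHol_gaugeAct_conj, GaugeGroup.reTr_conj]

/-- **(1.7) is gauge invariant** — p. 77: *"These conditions are invariant with respect to gauge transformations. It is obvious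
for (1.7), (1.8)."* — for the k-level plaquette clause `𝔄_k`'s *"|U(∂p) − 1| < α₀L^{−2j} for p ∈ Ω_j, j = 0, 1, …, k"*
(`B8SectAStatements.InAkOn`): `U^u ∈ (1.7) ↔ U ∈ (1.7)`, every `u`, every family `Ω`, every `k, L, α₀`.
[cite: Balaban1985RegularSpaces, (1.7) p.77] -/
theorem inAkOn_gaugeAct_iff (Ω : ℕ → Set (Plaq P j)) (k L : ℕ) (α₀ : ℝ) (u : GaugeTransf P j G)
    (U : GaugeField P j G) :
    B8SectAStatements.InAkOn Ω k L α₀ (gaugeAct u U) ↔ B8SectAStatements.InAkOn Ω k L α₀ U := by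
  unfold B8SectAStatements.InAkOn PlaqSmallOn
  simp only [dist1_plaqHol_gaugeAct]

/-- **(1.10) is gauge invariant** on one plaquette set: `η⁻⁴[1 − Re tr U^u(∂p)] = η⁻⁴[1 − Re tr U(∂p)]`, so
`B8SectAStatements.WilsonSmallOn S η ℓ α₀` holds for `U^u` iff it holds for `U`. [cite: Balaban1985RegularSpaces, (1.10) p.77] -/
theorem wilsonSmallOn_gaugeAct_iff (S : Set (Plaq P j)) (η ℓ α₀ : ℝ) (u : GaugeTransf P j G) (U : GaugeField P j G) :
    B8SectAStatements.WilsonSmallOn S η ℓ α₀ (gaugeAct u U) ↔ B8SectAStatements.WilsonSmallOn S η ℓ α₀ U := by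
  unfold B8SectAStatements.WilsonSmallOn
  simp only [reTr_plaqHol_gaugeAct]

/-- **(1.10) is gauge invariant**, k-level form `B8SectAStatements.InAkWilson` (*"(1.7) may be replaced by (1.10)"* — the
replacement keeps the invariance). [cite: Balaban1985RegularSpaces, (1.10) p.77] -/
theorem inAkWilson_gaugeAct_iff (Ω : ℕ → Set (Plaq P j)) (k : ℕ) (η : ℝ) (L : ℕ) (α₀ : ℝ) (u : GaugeTransf P j G)
    (U : GaugeField P j G) :
    B8SectAStatements.InAkWilson Ω k η L α₀ (gaugeAct u U) ↔ B8SectAStatements.InAkWilson Ω k η L α₀ U := by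
  unfold B8SectAStatements.InAkWilson
  simp only [wilsonSmallOn_gaugeAct_iff]

end ClassInvariance

section ClassInvarianceNormed

variable {V : Type*} [NormedAddCommGroup V] [NormedSpace ℝ V]

/-- **(1.9) is gauge invariant** — p. 77: *"To see that (1.9) is invariant also let us notice that (∂U^u)(p_{μν}(x)) =
R(u(x))(∂U)(p_{μν}(x)), and … (1.11). This and (1.2) imply the invariance."* — for the k-level bond clause of `𝔄_k`,
verbatim *"|(D^{η*}_U ∂U)(b)| < α₀L^{−2j}(Lʲη)⁻¹ for b ∈ Ω_j, (1.9)"*, `j = 0, 1, …, k`, written out over `covDivPlaq`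
(lattice factor `η⁻¹`) with the plaquette field `p ↦ ι(U(∂p))` (`hι`), `R` a representation (`hone`, `hmul`) with isometric
`R(u(x))` (`hiso`), over an arbitrary family of bond sets `Ωb`. [cite: Balaban1985RegularSpaces, (1.9) p.77] -/
theorem bondClause19_gaugeAct_iff {R : G → V →ₗ[ℝ] V} (hone : ∀ v, R 1 v = v)
    (hmul : ∀ (g h : G) (v : V), R (g * h) v = R g (R h v)) {ι : G → V}
    (hι : ∀ g h : G, ι (g * h * g⁻¹) = R g (ι h)) {u : GaugeTransf P j G}
    (hiso : ∀ (x : Site P j) (v : V), ‖R (u x) v‖ = ‖v‖) (Ωb : ℕ → Set (PBond P j)) (k L : ℕ) (η α₀ : ℝ)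
    (U : GaugeField P j G) :
    (∀ l ≤ k, ∀ b ∈ Ωb l, ‖covDivPlaq R η⁻¹ (gaugeAct u U) (fun p => ι (plaqHol (gaugeAct u U) p)) b‖
        < α₀ * (((L : ℝ) ^ l) ^ 2)⁻¹ * ((L : ℝ) ^ l * η)⁻¹) ↔
      (∀ l ≤ k, ∀ b ∈ Ωb l, ‖covDivPlaq R η⁻¹ U (fun p => ι (plaqHol U p)) b‖
        < α₀ * (((L : ℝ) ^ l) ^ 2)⁻¹ * ((L : ℝ) ^ l * η)⁻¹) := by
  simp only [norm_covDivPlaq_plaqHol_gaugeAct hone hmul hι hiso]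

/-- **"Thus the space 𝔄_k({Ω_j}, α₀) is invariant with respect to gauge transformations."** (p. 77) — `𝔄_k` read as the
conjunction of its plaquette clause (1.7) (`B8SectAStatements.InAkOn Ω k L α₀`) and its bond clause (1.9) (written out as in
`bondClause19_gaugeAct_iff`, bond sets `Ωb`): `U^u ∈ 𝔄_k ↔ U ∈ 𝔄_k` for every gauge transformation `u` with isometric
`R(u(x))`. [cite: Balaban1985RegularSpaces, (1.7)–(1.9) p.77] -/
theorem classAk_gaugeAct_iff {R : G → V →ₗ[ℝ] V} (hone : ∀ v, R 1 v = v)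
    (hmul : ∀ (g h : G) (v : V), R (g * h) v = R g (R h v)) {ι : G → V}
    (hι : ∀ g h : G, ι (g * h * g⁻¹) = R g (ι h)) {u : GaugeTransf P j G}
    (hiso : ∀ (x : Site P j) (v : V), ‖R (u x) v‖ = ‖v‖) (Ω : ℕ → Set (Plaq P j)) (Ωb : ℕ → Set (PBond P j))
    (k L : ℕ) (η α₀ : ℝ) (U : GaugeField P j G) :
    (B8SectAStatements.InAkOn Ω k L α₀ (gaugeAct u U) ∧
        ∀ l ≤ k, ∀ b ∈ Ωb l, ‖covDivPlaq R η⁻¹ (gaugeAct u U) (fun p => ι (plaqHol (gaugeAct u U) p)) b‖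
          < α₀ * (((L : ℝ) ^ l) ^ 2)⁻¹ * ((L : ℝ) ^ l * η)⁻¹) ↔
      (B8SectAStatements.InAkOn Ω k L α₀ U ∧
        ∀ l ≤ k, ∀ b ∈ Ωb l, ‖covDivPlaq R η⁻¹ U (fun p => ι (plaqHol U p)) b‖
          < α₀ * (((L : ℝ) ^ l) ^ 2)⁻¹ * ((L : ℝ) ^ l * η)⁻¹) :=
  (inAkOn_gaugeAct_iff Ω k L α₀ u U).and (bondClause19_gaugeAct_iff hone hmul hι hiso Ωb k L η α₀ U)

end ClassInvarianceNormed

end Literature.MathematicalPhysics.QuantumFieldTheory.Balaban1983to89.B8Eq111SiteCovariance
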